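import Summits.ResolutionOfSingularities.ResolutionOfSingularities.Theses.RuledResidues
import Literature.AlgebraicGeometry.Resolution.QuadraticTransformsProofs
import Literature.AlgebraicGeometry.Resolution.QuadraticTransformsUFD
import Literature.AlgebraicGeometry.Resolution.BlowupAlgebraPresentation
import Literature.AlgebraicGeometry.Resolution.DivisorialPlace
import HarnessLib

/-!
# `RuledResidues.RegularModelRuled` (stmt-ResolutionOfSingularities-18077), part 2/3 — the exceptional prime and its residue field

Route `ResolutionOfSingularities/RuledResidues`, crux `RegularModelRuled`, line `dvr-descent`.
For a regular local ring `S ⊆ K` of dimension `c + 1 ≥ 2` DOMINATED by the DVR `O` whose quadratic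
transform along `O` is `O` itself: `O = S[𝔪_S/x_i]_{(x_i)}` is the local ring of the exceptional
prime of a chart; `S[𝔪/x_i]/(x_i) ≅ κ(S)[T_j : j ≠ i]` (`chartQuotient`, via the affine blowup
algebra `blowupAlgebra 𝔪 x_i ≅ blowupRing` and `blowupAlgebra.comap_eval_span_algebraMap_eq`);
the centre of `O` on the chart IS that exceptional prime (`centreEqOfPrime`: a height-one prime
containing a nonzero prime element, `Ideal.eq_span_singleton_of_height_eq_one`); hence
`κ(O) ≅ Frac κ(S)[X₁, …, X_c]` compatibly with `S → O` (`exceptionalResidue`).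
Parts 1/3: `RuledResiduesRegularModelRuledReach.lean`, `RuledResiduesRegularModelRuled.lean`.

References: Abhyankar 1956, *On the valuations centered in a local domain*, Prop. 3;
Stacks 0BIQ; Zariski–Samuel II, App. 5.
-/

-- single-problem summit: the doubled namespace component `ResolutionOfSingularities` is forced
set_option linter.dupNamespace false

namespace Summit.ResolutionOfSingularities.ResolutionOfSingularities.Theorems.RuledResiduesRegularModelRuled

open IsLocalRing Literature.AlgebraicGeometry.Resolution IsDiscreteValuationRing

noncomputable section

/-! ## The exceptional prime and its residue field -/

section Exceptional

variable {K : Type} [Field K]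

local notation3 "𝓐[" x "," i "]" => blowupAlgebra (Ideal.span (Set.range x)) (x i)

/-- **The centre of a DVR on a model is any nonzero principal prime it contains** (was stub A,
PROVED). Let `B ⊆ O` be a subring of `K` with `O = B_{𝔪_O ∩ B}` a discrete valuation ring, and
`p ∈ B` nonzero of positive value with `p B` prime. Then every element of `B` of positive value
is a multiple of `p` in `B`: the centre `𝔮 = 𝔪_O ∩ B` has height `dim O = 1`
(`IsLocalization.AtPrime.ringKrullDim_eq_height`) and contains the prime element `p`, so
`𝔮 = p B` (`Ideal.eq_span_singleton_of_height_eq_one`). -/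
theorem centreEqOfPrime (O : ValuationSubring K) [IsDiscreteValuationRing O]
    (B : Subring K) (hBO : B ≤ O.toSubring)
    (hO : O.toSubring = locAtCentre B O) {p : K} (hpB : p ∈ B) (hp0 : p ≠ 0)
    (hvp : O.valuation p < 1) (hprime : (Ideal.span {(⟨p, hpB⟩ : B)}).IsPrime) :
    ∀ z ∈ B, O.valuation z < 1 → ∃ w ∈ B, z = w * p := by
  intro z hz hvz
  haveI := isLocalization_locAtCentre hBO
  -- the centre has height `dim O = 1`
  have hdimloc : ringKrullDim (locAtCentre B O) = 1 := by
    rw [ringKrullDim_eq_of_ringEquiv (RingEquiv.subringCongr hO.symm)]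
    exact IsDiscreteValuationRing.ringKrullDim_eq_one O
  have hht : (subringCentre B O hBO).height = 1 := by
    have h := IsLocalization.AtPrime.ringKrullDim_eq_height (subringCentre B O hBO) (locAtCentre B O)
    rw [hdimloc] at h
    exact_mod_cast h.symm
  -- `p` is a prime element of the centre
  have hpB0 : (⟨p, hpB⟩ : B) ≠ 0 := fun h => hp0 (congrArg Subtype.val h)
  have hprimeElt : Prime (⟨p, hpB⟩ : B) := (Ideal.span_singleton_prime hpB0).mp hprime
  have hpq : (⟨p, hpB⟩ : B) ∈ subringCentre B O hBO := (mem_subringCentre_iff hBO _).mpr hvp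
  have heq : subringCentre B O hBO = Ideal.span {(⟨p, hpB⟩ : B)} :=
    Ideal.eq_span_singleton_of_height_eq_one hht hpq hprimeElt
  have hzq : (⟨z, hz⟩ : B) ∈ subringCentre B O hBO := (mem_subringCentre_iff hBO _).mpr hvz
  rw [heq, Ideal.mem_span_singleton'] at hzq
  obtain ⟨w, hw⟩ := hzq
  refine ⟨w, w.2, ?_⟩
  have := congrArg Subtype.val hw
  simpa [Subring.coe_mul] using this.symm

/-- **The exceptional fibre of the chart is an affine space** (was stub B, PROVED; Stacks 0BIQ
for the regular system of parameters `x` of the regular local ring `S ⊆ K`):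
`S[𝔪/x_i]/(x_i) ≅ κ(S)[T_j : j ≠ i]`, compatibly with `S → S[𝔪/x_i]`. The affine blowup algebra
`S[𝔪/x_i] ⊆ S[1/x_i]` (`blowupAlgebra`) maps isomorphically onto `blowupRing S x_i ⊆ K` under
`S[1/x_i] → K`; modulo `x_i` its presentation `S[T_j : j ≠ i] → S[𝔪/x_i]` has kernel `𝔪 · S[T]`
(`blowupAlgebra.comap_eval_span_algebraMap_eq`, quasi-regularity of `x`), which is the kernel of
`S[T] → κ(S)[T]`. -/
theorem chartQuotient (S : Subring K) [IsRegularLocalRing S] {d : ℕ}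
    (hd : (maximalIdeal S).spanFinrank = d) (x : Fin d → S)
    (hx : Ideal.span (Set.range x) = maximalIdeal S) (i : Fin d) (hxi : x i ≠ 0) :
    ∃ ψ : MvPolynomial {j : Fin d // j ≠ i} (ResidueField S) →+*
        blowupRing S (x i : K) ⧸
          Ideal.span {(⟨(x i : K), le_blowupRing S (x i : K) (x i).2⟩ : blowupRing S (x i : K))},
      Function.Bijective ψ ∧
      ∀ s : S, ψ (MvPolynomial.C (residue S s)) =
        Ideal.Quotient.mk _ ⟨(s : K), le_blowupRing S (x i : K) s.2⟩ := by
  classical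
  have hxm : ∀ j, x j ∈ maximalIdeal S := fun j => hx ▸ Ideal.subset_span ⟨j, rfl⟩
  have hθ : ((x i : S) : K) ≠ 0 := fun h => hxi (Subtype.ext h)
  have hunit : IsUnit (S.subtype (x i)) := isUnit_iff_ne_zero.mpr hθ
  -- `Θ : S[1/x_i] → K` and `g : S[𝔪/x_i] → K`
  let Θ : Localization.Away (x i) →+* K := IsLocalization.Away.lift (x i) hunit
  have hΘalg : ∀ s : S, Θ (algebraMap S (Localization.Away (x i)) s) = (s : K) := fun s =>
    IsLocalization.Away.lift_eq (x i) hunit s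
  have hΘinv : Θ (IsLocalization.Away.invSelf (x i)) = ((x i : S) : K)⁻¹ := by
    apply eq_inv_of_mul_eq_one_left
    rw [← hΘalg (x i), ← map_mul, mul_comm, IsLocalization.Away.mul_invSelf, map_one]
  let g : 𝓐[x, i] →+* K := Θ.comp (𝓐[x, i]).val.toRingHom
  have hgalg : ∀ s : S, g (algebraMap S 𝓐[x, i] s) = (s : K) := fun s => hΘalg s
  have hgfrac : ∀ j : Fin d, g (blowupAlgebra.frac x i j) = ((x j : S) : K) / ((x i : S) : K) := by
    intro j
    change Θ ((blowupAlgebra.frac x i j : Localization.Away (x i))) = _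
    rw [blowupAlgebra.coe_frac, map_mul, hΘalg, hΘinv, div_eq_mul_inv]
  -- `g ∘ eval = eval₂ (x_j/x_i)`
  have hgeval : g.comp (blowupAlgebra.eval x i).toRingHom =
      MvPolynomial.eval₂Hom S.subtype
        (fun j : {j : Fin d // j ≠ i} => ((x j.1 : S) : K) / ((x i : S) : K)) := by
    refine (blowupAlgebra.comp_val_comp_eval x i Θ).trans ?_
    congr 1
    · ext s
      exact hΘalg s
    · funext j
      exact hgfrac j.1
  have hgeval' : ∀ P, g (blowupAlgebra.eval x i P) = MvPolynomial.eval₂Hom S.subtype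
      (fun j : {j : Fin d // j ≠ i} => ((x j.1 : S) : K) / ((x i : S) : K)) P := fun P => by
    rw [← hgeval]; rfl
  -- the range of `g` is `S[𝔪/x_i] ⊆ K`
  have heval_mem : ∀ P : MvPolynomial {j : Fin d // j ≠ i} S, MvPolynomial.eval₂Hom S.subtype
      (fun j : {j : Fin d // j ≠ i} => ((x j.1 : S) : K) / ((x i : S) : K)) P ∈
        blowupRing S (x i : K) := by
    intro P
    induction P using MvPolynomial.induction_on with
    | C s =>
      rw [MvPolynomial.eval₂Hom_C]
      exact le_blowupRing S _ s.2
    | add p q hp hq =>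
      rw [map_add]
      exact Subring.add_mem _ hp hq
    | mul_X p j hp =>
      rw [map_mul, MvPolynomial.eval₂Hom_X']
      exact Subring.mul_mem _ hp (div_mem_blowupRing _ (hxm j.1))
  have hrange : g.range = blowupRing S (x i : K) := by
    apply le_antisymm
    · rintro _ ⟨z, rfl⟩
      obtain ⟨P, rfl⟩ := blowupAlgebra.eval_surjective x i z
      rw [hgeval']
      exact heval_mem P
    · rw [blowupRing_eq_closure_of_span_eq ((x i : S) : K) (Set.range x) hx, Subring.closure_le]
      rintro z (hz | ⟨y, ⟨j, rfl⟩, rfl⟩)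
      · exact ⟨algebraMap S _ ⟨z, hz⟩, hgalg ⟨z, hz⟩⟩
      · exact ⟨blowupAlgebra.frac x i j, hgfrac j⟩
  -- `g` is injective
  have hΘinj : ∀ z, Θ z = 0 → z = 0 := by
    intro z hz
    obtain ⟨⟨r, s⟩, hrs⟩ := IsLocalization.surj (Submonoid.powers (x i)) z
    have hr : (r : K) = 0 := by
      have h := congrArg Θ hrs
      rw [map_mul, hz, zero_mul, hΘalg] at h
      exact h.symm
    have hr0 : r = 0 := Subtype.ext hr
    rw [hr0, map_zero] at hrs
    exact (IsUnit.mul_left_eq_zero (IsLocalization.map_units _ s)).mp hrs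
  have hginj : Function.Injective g := by
    intro a b h
    apply Subtype.ext
    have h0 : Θ ((a : Localization.Away (x i)) - b) = 0 := by
      rw [map_sub]
      exact sub_eq_zero.mpr h
    exact sub_eq_zero.mp (hΘinj _ h0)
  -- `e₁ : S[𝔪/x_i] ≃ blowupRing S x_i`
  have hmem : ∀ b, g b ∈ blowupRing S (x i : K) := fun b => by rw [← hrange]; exact ⟨b, rfl⟩
  let g' : 𝓐[x, i] →+* blowupRing S (x i : K) := g.codRestrict _ hmem
  have hg' : Function.Bijective g' := by
    refine ⟨fun a b h => hginj (congrArg Subtype.val h), fun z => ?_⟩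
    have hz : (z : K) ∈ g.range := by rw [hrange]; exact z.2
    obtain ⟨b, hb⟩ := hz
    exact ⟨b, Subtype.ext hb⟩
  let e₁ : 𝓐[x, i] ≃+* blowupRing S (x i : K) := RingEquiv.ofBijective g' hg'
  have he₁alg : ∀ s : S, e₁ (algebraMap S 𝓐[x, i] s) = ⟨(s : K), le_blowupRing S (x i : K) s.2⟩ :=
    fun s => Subtype.ext (hgalg s)
  -- the presentation modulo `x_i`: `S[T] → S[𝔪/x_i]/(x_i)` is onto with kernel `𝔪 · S[T]`
  let J : Ideal 𝓐[x, i] := Ideal.span {algebraMap S 𝓐[x, i] (x i)}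
  let π : MvPolynomial {j : Fin d // j ≠ i} S →+* 𝓐[x, i] ⧸ J :=
    (Ideal.Quotient.mk J).comp (blowupAlgebra.eval x i).toRingHom
  have hπsurj : Function.Surjective π :=
    Ideal.Quotient.mk_surjective.comp (blowupAlgebra.eval_surjective x i)
  have hπker : RingHom.ker π = Ideal.map MvPolynomial.C (Ideal.span (Set.range x)) := by
    change RingHom.ker ((Ideal.Quotient.mk J).comp _) = _
    rw [← RingHom.comap_ker, Ideal.mk_ker]
    exact blowupAlgebra.comap_eval_span_algebraMap_eq x i
      (isQuasiRegular_regularSystemOfParameters hd x hx)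
  -- `S[T] → κ(S)[T]` is onto with the same kernel
  let σ : MvPolynomial {j : Fin d // j ≠ i} S →+* MvPolynomial {j : Fin d // j ≠ i} (ResidueField S) :=
    MvPolynomial.map (residue S)
  have hσsurj : Function.Surjective σ := MvPolynomial.map_surjective _ residue_surjective
  have hσker : RingHom.ker σ = Ideal.map MvPolynomial.C (Ideal.span (Set.range x)) := by
    change RingHom.ker (MvPolynomial.map (residue S)) = _
    rw [MvPolynomial.ker_map, ker_residue, hx]
  -- hence `ψ' : κ(S)[T] → S[𝔪/x_i]/(x_i)`, a bijection
  let ψ' : MvPolynomial {j : Fin d // j ≠ i} (ResidueField S) →+* 𝓐[x, i] ⧸ J :=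
    σ.liftOfSurjective hσsurj ⟨π, by rw [hσker, hπker]⟩
  have hψ'σ : ∀ P, ψ' (σ P) = π P := fun P =>
    σ.liftOfSurjective_comp_apply hσsurj ⟨π, by rw [hσker, hπker]⟩ P
  have hψ'bij : Function.Bijective ψ' := by
    constructor
    · refine (injective_iff_map_eq_zero ψ').mpr fun Q hQ => ?_
      obtain ⟨P, rfl⟩ := hσsurj Q
      rw [hψ'σ] at hQ
      have hP : P ∈ RingHom.ker σ := by rw [hσker, ← hπker]; exact hQ
      exact hP
    · intro z
      obtain ⟨P, rfl⟩ := hπsurj z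
      exact ⟨σ P, hψ'σ P⟩
  -- transport `S[𝔪/x_i]/(x_i) ≅ blowupRing/(x_i)` along `e₁`
  let J' : Ideal (blowupRing S (x i : K)) :=
    Ideal.span {(⟨(x i : K), le_blowupRing S (x i : K) (x i).2⟩ : blowupRing S (x i : K))}
  have hJJ' : J' = J.map (e₁ : 𝓐[x, i] →+* blowupRing S (x i : K)) := by
    change Ideal.span _ = Ideal.map _ (Ideal.span _)
    rw [Ideal.map_span, Set.image_singleton]
    congr 2
    exact (he₁alg (x i)).symm
  let q : 𝓐[x, i] ⧸ J ≃+* blowupRing S (x i : K) ⧸ J' := Ideal.quotientEquiv J J' e₁ hJJ'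
  refine ⟨q.toRingHom.comp ψ', q.bijective.comp hψ'bij, fun s => ?_⟩
  -- constants: `C s̄ ↦ [s/1] ↦ [s]`
  have hσC : σ (MvPolynomial.C s) = MvPolynomial.C (residue S s) := MvPolynomial.map_C _ _
  change q (ψ' (MvPolynomial.C (residue S s))) = _
  rw [← hσC, hψ'σ]
  change q (Ideal.Quotient.mk J ((blowupAlgebra.eval x i) (MvPolynomial.C s))) = _
  rw [blowupAlgebra.eval_C, Ideal.quotientEquiv_mk]
  congr 1
  exact he₁alg s

end Exceptional

/-- **Residue field of the exceptional prime** (from `centreEqOfPrime` and `chartQuotient`):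
for a regular local ring `S ⊆ K` of dimension `c + 1 ≥ 2` DOMINATED by the DVR `O` and whose
quadratic transform along `O` is `O` itself, `κ(O)` is the fraction field of `κ(S)[X₁, …, X_c]`
through an injective `ι` compatible with `S → O`. -/
theorem exceptionalResidue {K : Type} [Field K] (O : ValuationSubring K) [IsDiscreteValuationRing O]
    (S : Subring K) (hreg : IsRegularLocalRing S) (hdim : (2 : WithBot ℕ∞) ≤ ringKrullDim S)
    (hdom : SubringDominates S O.toSubring) (hS : IsQuadraticTransformAlong O S O.toSubring) :
    ∃ (c : ℕ) (_ : 1 ≤ c) (ι : MvPolynomial (Fin c) (ResidueField S) →+* ResidueField O),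
      Function.Injective ι ∧
      (∀ z : ResidueField O, ∃ p q : MvPolynomial (Fin c) (ResidueField S),
        ι q ≠ 0 ∧ z * ι q = ι p) ∧
      ∀ s : S, ι (MvPolynomial.C (residue S s)) = residue O ⟨(s : K), hS.source_le s.2⟩ := by
  classical
  have hSO := hS.source_le
  -- a regular system of parameters; the dimension is `d ≥ 2`
  obtain ⟨x, hx⟩ := exists_regularSystemOfParameters (R := S)
  have h2d : 2 ≤ (maximalIdeal S).spanFinrank := by
    have h1 := (isRegularLocalRing_iff S).mp hreg
    rw [← h1] at hdim
    exact_mod_cast hdim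
  haveI : Nontrivial (Fin (maximalIdeal S).spanFinrank) := Fin.nontrivial_iff_two_le.mpr h2d
  -- the parameters are nonzero non-units, of positive value
  have hx0 : ∀ j, x j ≠ 0 := by
    intro j h
    have := not_mem_span_image_of_not_mem rfl x hx (S := ∅) (i := j) (Set.notMem_empty j)
    rw [Set.image_empty, Ideal.span_empty, h] at this
    exact this (Submodule.zero_mem ⊥)
  have hx0' : ∀ j, ((x j : S) : K) ≠ 0 := fun j h => hx0 j (Subtype.ext h)
  have hxm : ∀ j, x j ∈ maximalIdeal S := fun j => hx ▸ Ideal.subset_span ⟨j, rfl⟩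
  have hvx : ∀ j, O.valuation ((x j : S) : K) < 1 := fun j =>
    valuation_lt_one_of_subringDominates hdom (x j).2 fun hinv =>
      ((mem_maximalIdeal_iff_inv_not_mem (x j)).mp (hxm j)).elim (fun h0 => hx0' j h0)
        (fun h => h hinv)
  -- a parameter of minimal value and the transform along `O` in its chart (as in the tree)
  obtain ⟨j₀, -, -⟩ := exists_pair_ne (Fin (maximalIdeal S).spanFinrank)
  obtain ⟨i, -, hi0, hmax⟩ := exists_max_valuation O Finset.univ (fun j => ((x j : S) : K))
    ⟨j₀, Finset.mem_univ _, hx0' j₀⟩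
  have hspan : Ideal.span (↑(Finset.univ.image x) : Set S) = maximalIdeal S := by
    rw [Finset.coe_image, Finset.coe_univ, Set.image_univ, hx]
  haveI : IsLocalRing S := hreg.toIsLocalRing
  have h' : IsQuadraticTransformAlong O S (locAtCentre (blowupRing S (x i : K)) O) := by
    refine ⟨‹_›, hSO, Finset.univ.image x, x i, hspan, Finset.mem_image_of_mem x (Finset.mem_univ i),
      hx0 i, ?_, ?_⟩
    · intro y hy
      obtain ⟨j, -, rfl⟩ := Finset.mem_image.mp hy
      exact hmax j (Finset.mem_univ j)
    · rw [blowupRing_eq_closure_of_span_eq (x i : K) _ hspan]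
  have hO : O.toSubring = locAtCentre (blowupRing S (x i : K)) O := hS.unique h'
  set B : Subring K := blowupRing S (x i : K) with hB
  have hBO : B ≤ O.toSubring := by rw [hO]; exact le_locAtCentre B O
  haveI : IsRegularRing B := isRegularRing_blowupRing S rfl x hx i
  -- stub B: the exceptional fibre, and primality of `(x_i)`
  obtain ⟨ψ, hψ, hψC⟩ := chartQuotient (K := K) S rfl x hx i (hx0 i)
  let pB : B := ⟨(x i : K), le_blowupRing S (x i : K) (x i).2⟩
  haveI hprime : (Ideal.span {pB}).IsPrime := by
    rw [← Ideal.Quotient.isDomain_iff_prime]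
    exact MulEquiv.isDomain (MvPolynomial {j // j ≠ i} (ResidueField S))
      (RingEquiv.ofBijective ψ hψ).symm.toMulEquiv
  -- stub A: the centre of `O` on `B` is `(x_i)`
  have hcentre := centreEqOfPrime O B hBO hO (le_blowupRing S (x i : K) (x i).2) (hx0' i)
    (hvx i) hprime
  -- the residue map `r : B → κ(O)` and its kernel
  let incl : B →+* O := Subring.inclusion hBO
  let r : B →+* ResidueField O := (residue O).comp incl
  have hr_zero : ∀ b : B, r b = 0 ↔ O.valuation (b : K) < 1 := fun b => by
    change residue O (incl b) = 0 ↔ _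
    rw [residue_eq_zero_iff, ValuationSubring.valuation_lt_one_iff]
    rfl
  have hker : ∀ b : B, r b = 0 ↔ b ∈ Ideal.span {pB} := fun b => by
    rw [hr_zero, Ideal.mem_span_singleton']
    constructor
    · intro hv
      obtain ⟨w, hw, hbw⟩ := hcentre b b.2 hv
      exact ⟨⟨w, hw⟩, Subtype.ext hbw.symm⟩
    · rintro ⟨a, ha⟩
      have hb : (b : K) = (a : K) * (x i : K) := by rw [← ha]; rfl
      rw [hb, map_mul]
      calc O.valuation (a : K) * O.valuation ((x i : S) : K)
          ≤ 1 * O.valuation ((x i : S) : K) :=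
            mul_le_mul_left ((O.valuation_le_one_iff _).mpr (hBO a.2)) _
        _ = O.valuation ((x i : S) : K) := one_mul _
        _ < 1 := hvx i
  let rbar : B ⧸ Ideal.span {pB} →+* ResidueField O :=
    Ideal.Quotient.lift _ r (fun b hb => (hker b).mpr hb)
  have hrbar : Function.Injective rbar :=
    RingHom.lift_injective_of_ker_le_ideal _ (fun b hb => (hker b).mpr hb)
      (fun b hb => (hker b).mp hb)
  -- reindex the variables by `Fin c`, `c = d - 1 ≥ 1`
  obtain ⟨j₁, hj₁⟩ := exists_ne i
  set c := Fintype.card {j : Fin (maximalIdeal S).spanFinrank // j ≠ i} with hc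
  have h1c : 1 ≤ c := Fintype.card_pos_iff.mpr ⟨⟨j₁, hj₁⟩⟩
  let e : {j : Fin (maximalIdeal S).spanFinrank // j ≠ i} ≃ Fin c := Fintype.equivFin _
  let ρ : MvPolynomial (Fin c) (ResidueField S) →+*
      MvPolynomial {j : Fin (maximalIdeal S).spanFinrank // j ≠ i} (ResidueField S) :=
    (MvPolynomial.renameEquiv (ResidueField S) e.symm).toRingEquiv.toRingHom
  have hρ : Function.Bijective ρ := (MvPolynomial.renameEquiv (ResidueField S) e.symm).bijective
  have hψρ_inj : Function.Injective (ψ.comp ρ) := hψ.1.comp hρ.1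
  have hsurj : Function.Surjective (ψ.comp ρ) := hψ.2.comp hρ.2
  refine ⟨c, h1c, rbar.comp (ψ.comp ρ), hrbar.comp hψρ_inj, ?_, ?_⟩
  · intro z
    obtain ⟨z', rfl⟩ := IsLocalRing.residue_surjective z
    have hz' : (z' : K) ∈ locAtCentre B O := by rw [← hO]; exact z'.2
    obtain ⟨y, hy, w, hw, hvw, hzyw⟩ := hz'
    obtain ⟨p, hp⟩ := hsurj (Ideal.Quotient.mk _ ⟨y, hy⟩)
    obtain ⟨q, hq⟩ := hsurj (Ideal.Quotient.mk _ ⟨w, hw⟩)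
    refine ⟨p, q, ?_, ?_⟩
    · change rbar ((ψ.comp ρ) q) ≠ 0
      rw [hq, Ideal.Quotient.lift_mk, Ne, hr_zero]
      exact fun hlt => (lt_irrefl (1 : _)) (hvw ▸ hlt)
    · change residue O z' * rbar ((ψ.comp ρ) q) = rbar ((ψ.comp ρ) p)
      rw [hq, hp, Ideal.Quotient.lift_mk, Ideal.Quotient.lift_mk]
      change residue O z' * residue O (incl ⟨w, hw⟩) = residue O (incl ⟨y, hy⟩)
      rw [← map_mul]
      congr 1
      apply Subtype.ext
      change (z' : K) * w = y
      rw [hzyw, div_mul_cancel₀ _ (ne_zero_of_valuation_eq_one hvw)]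
  · intro s
    change rbar (ψ (ρ (MvPolynomial.C (residue S s)))) = _
    have hρC : ρ (MvPolynomial.C (residue S s)) = MvPolynomial.C (residue S s) :=
      MvPolynomial.rename_C _ _
    rw [hρC, hψC, Ideal.Quotient.lift_mk]
    rfl

end

end Summit.ResolutionOfSingularities.ResolutionOfSingularities.Theorems.RuledResiduesRegularModelRuled
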